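import Literature.NumberTheory.Automorphic.FlathBaseVector
import Literature.NumberTheory.Automorphic.UnitaryGroupPlaceInclusion
import Literature.NumberTheory.Automorphic.ParabolicInductionAdmissibleProofs
import Mathlib.RingTheory.SimpleModule.Isotypic
import Mathlib.RepresentationTheory.Irreducible
import HarnessLib

/-!
# Stub CL of the (C)-line `Cruxes/H413/Lines/F0_P2CohFinComponentIsThetaC.lean`: an irreducible admissible representation of
# `U(J)(𝔸_{F,f})` has an irreducible LOCAL TYPE at every finite place (floor-0 (C)-desk of the Hodge cell, seat F0P2-p03 (g2))

Namespace `Summit.HodgeConjecture.HodgeConjecture.Cruxes.H413.F0P2cStubCLLocalTypeExists`.  THEOREMS ONLY (no `def`, no named fact, no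
`sorry`); never imports `Cruxes/…/Lines/…` (s347).  Imports ★ `FlathBaseVector` (purification `exists_purified_at`, boxes
`exists_boxSubgroup_fixedPoints_ne_bot`), ★ `UnitaryGroupPlaceInclusion` (`inclPlace`, `exists_eq_mul_inclPlace`,
`commute_inclPlace_of_evalPlace_eq_one`), ★ `UnitaryGroupRestrictedProduct` (`finAdelicEquiv : U(J)(𝔸_{F,f}) ≃ₜ* Πʳ_v (U(J)(F_v) : U(J)(𝒪_v))`),
★ `ParabolicInductionAdmissibleProofs` (`IsAdmissible.comp_mulEquiv`), Mathlib `isotypicComponent`, `Subrepresentation`,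
`IntertwiningMap.equivLinearMapAsModule`.

* `isIrreducible_comp_mulEquiv` — irreducibility is transported along a group isomorphism.
* `isotypicComponent_place_eq_top_of_ne_bot` — BRICK (iv) of PLAN-P2 (C): for an IRREDUCIBLE `σ` of `U(J)(𝔸_{F,f})`, a finite place `v` and a
  simple `ℂ[U(J)(F_v)]`-module `S`, the `S`-isotypic component of `σ|_{U(J)(F_v)}` (restriction along ★ `inclPlace v`) is `⊤` as soon as it is
  non-zero: it is stable under `ι_v(U(J)(F_v))` (a `ℂ[U(J)(F_v)]`-submodule) and under every `σ(g′)` with `g′_v = 1` — such `σ(g′)` COMMUTE with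
  `ι_v(U(J)(F_v))` (★ `commute_inclPlace_of_evalPlace_eq_one`), i.e. are `ℂ[U(J)(F_v)]`-linear, and linear maps preserve isotypic components
  (Mathlib `LinearMap.le_comap_isotypicComponent`); since `g = g′ · ι_v(g_v)` (★ `exists_eq_mul_inclPlace`) it is a subrepresentation of `σ`.
* `stubCL_holds` — THE STUB: the registered body of `StubCLLocalTypeExists` with the Lines-local bundle
  `IsLocalTypeAt F E c N J ρ v τ := τ.IsIrreducible ∧ isotypicComponent ℂ[U(J)(F_v)] (ρ.comp (inclPlace v)).asModule τ.asModule = ⊤` unfolded.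
  PROOF (Flath's purification, print: [FlathCorvallis1979, proof of Thm. 2 and §2 Example 2]; [Bump1997, §3.4 Prop. 3.4.1 / Thm. 3.4.4] — WITHOUT
  Gelfand pairs, unitarity or finite length): transport `σ` along ★ `finAdelicEquiv` to a representation `π` of the restricted product;
  smoothness gives a box `U = ∏ L_w` with `W^U ≠ 0`, admissibility makes it finite-dimensional, and ★ `exists_purified_at` (a cyclic
  `U(J)(F_v)`-module of minimal `U`-fixed dimension, dichotomy ★ `inf_fixedPoints_comp_ne_bot`) yields `w′ ≠ 0` whose cyclic module `C_v(w′)` has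
  no proper non-zero `U(J)(F_v)`-stable subspace; `τ := σ|_{U(J)(F_v)}` on `C_v(w′)` is irreducible and its isotypic component contains
  `C_v(w′) ≠ 0`, so it is `⊤` by brick (iv).
HC_CM is proved only modulo the printed citations until rung 0 closes.

## References
* [FlathCorvallis1979] D. Flath, *Decomposition of representations into tensor products*, PSPM 33.1 (1979), Thm. 2, Thm. 3, §2 Example 2.
* [Bump1997] D. Bump, *Automorphic Forms and Representations* (1997), §3.4 (Prop. 3.4.1, Thm. 3.4.2, Thm. 3.4.4).
* [BorelJacquet1979] A. Borel, H. Jacquet, *Automorphic forms and automorphic representations*, PSPM 33.1 (1979), §4.3.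
-/

set_option autoImplicit false
set_option linter.dupNamespace false

noncomputable section

open NumberField IsDedekindDomain
open scoped RestrictedProduct

namespace Summit.HodgeConjecture.HodgeConjecture.Cruxes.H413.F0P2cStubCLLocalTypeExists

open Literature.NumberTheory.Automorphic Literature.NumberTheory.Automorphic.UnitaryGroup

/-- **Irreducibility is transported along a group isomorphism**: the subrepresentations of `σ ∘ e` and of `σ` are the same subspaces
(`e` surjective), so the two lattices are order-isomorphic. [cite: BorelJacquet1979, §4.3] -/
theorem isIrreducible_comp_mulEquiv {G H W : Type*} [Group G] [Group H] [AddCommGroup W] [Module ℂ W]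
    (σ : Representation ℂ H W) [hσ : σ.IsIrreducible] (e : G ≃* H) :
    Representation.IsIrreducible (V := W) (σ.comp e.toMonoidHom) := by
  let Φ : Subrepresentation (W := W) (σ.comp e.toMonoidHom) ≃o Subrepresentation σ :=
    { toFun := fun N => ⟨N.toSubmodule, fun h w hw => by
        have := N.apply_mem_toSubmodule (e.symm h) hw
        simpa using this⟩
      invFun := fun N => ⟨N.toSubmodule, fun g w hw => N.apply_mem_toSubmodule (e g) hw⟩
      left_inv := fun N => rfl
      right_inv := fun N => rfl
      map_rel_iff' := Iff.rfl }
  exact Φ.isSimpleOrder_iff.mpr hσ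

/-- **BRICK (iv) — the isotypic components of `σ|_{U(J)(F_v)}` of an irreducible `σ` are `⊥` or `⊤`.**  For an irreducible representation `σ`
of `U(J)(𝔸_{F,f})` on `W`, a finite place `v` and a simple `ℂ[U(J)(F_v)]`-module `S`, if the `S`-isotypic component of the restriction of `σ`
along `inclPlace v` is non-zero then it is everything: it is a `U(J)(F_v)`-stable subspace, stable under every `σ(g′)` with `g′_v = 1`
(these commute with `ι_v(U(J)(F_v))`, hence are `ℂ[U(J)(F_v)]`-linear and preserve isotypic components), and `g = g′ · ι_v(g_v)`; so it is
a non-zero subrepresentation of the irreducible `σ`. [cite: FlathCorvallis1979, §2 Example 2] [cite: Bump1997, §3.4 Prop. 3.4.1] -/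
theorem isotypicComponent_place_eq_top_of_ne_bot
    (F E : Type) [Field F] [NumberField F] [Field E] [NumberField E] [Algebra F E] (c : E ≃ₐ[F] E) (N : ℕ)
    (J : Matrix (Fin N) (Fin N) E) {W : Type} [AddCommGroup W] [Module ℂ W] {σ : Representation ℂ (finAdelic F E c N J) W}
    (hirr : σ.IsIrreducible) (v : HeightOneSpectrum (𝓞 F)) (S : Type*) [AddCommGroup S]
    [Module (MonoidAlgebra ℂ (localPi E c N J v)) S] [IsSimpleModule (MonoidAlgebra ℂ (localPi E c N J v)) S]
    (hne : isotypicComponent (MonoidAlgebra ℂ (localPi E c N J v))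
      (Representation.asModule (σ.comp (inclPlace F E c N J v))) S ≠ ⊥) :
    isotypicComponent (MonoidAlgebra ℂ (localPi E c N J v))
      (Representation.asModule (σ.comp (inclPlace F E c N J v))) S = ⊤ := by
  -- the isotypic component `C` of `S` is stable under every `σ g`
  let C : Submodule (MonoidAlgebra ℂ (localPi E c N J v))
      (Representation.asModule (σ.comp (inclPlace F E c N J v))) :=
    isotypicComponent (MonoidAlgebra ℂ (localPi E c N J v))
      (Representation.asModule (σ.comp (inclPlace F E c N J v))) S
  have hCι : ∀ (x : localPi E c N J v) {m : W}, m ∈ C → σ (inclPlace F E c N J v x) m ∈ C := fun x m hm =>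
    (Subrepresentation.ofSubmodule' C).apply_mem_toSubmodule x hm
  have hC1 : ∀ {g : finAdelic F E c N J}, evalPlace F E c N J v g = 1 → ∀ {m : W}, m ∈ C → σ g m ∈ C := by
    intro g hg m hm
    -- `σ g` commutes with `σ ∘ ι_v`, hence is `ℂ[U(J)(F_v)]`-linear and preserves isotypic components
    let f : Representation.IntertwiningMap (σ.comp (inclPlace F E c N J v)) (σ.comp (inclPlace F E c N J v)) :=
      LinearMap.intertwiningMap_of_isIntertwiningMap _ _ (σ g) fun x w => by
        show σ g (σ (inclPlace F E c N J v x) w) = σ (inclPlace F E c N J v x) (σ g w)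
        rw [← Module.End.mul_apply, ← map_mul, (commute_inclPlace_of_evalPlace_eq_one F E c N J hg x).eq, map_mul,
          Module.End.mul_apply]
    exact LinearMap.le_comap_isotypicComponent (S := S)
      (Representation.IntertwiningMap.equivLinearMapAsModule (σ.comp (inclPlace F E c N J v))
        (σ.comp (inclPlace F E c N J v)) f) hm
  let Cσ : Subrepresentation σ :=
    { toSubmodule := (Subrepresentation.ofSubmodule' C).toSubmodule
      apply_mem_toSubmodule := fun g m hm => by
        obtain ⟨g', hg'1, -, hgeq⟩ := exists_eq_mul_inclPlace F E c N J v g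
        have hm' : m ∈ C := hm
        show σ g m ∈ C
        rw [hgeq, map_mul, Module.End.mul_apply]
        exact hC1 hg'1 (hCι _ hm') }
  have hCσ_ne : Cσ ≠ ⊥ := by
    intro h0
    apply hne
    rw [eq_bot_iff]
    intro m hm
    have hm' : (m : W) ∈ Cσ := hm
    rw [h0] at hm'
    rw [Submodule.mem_bot]
    exact hm'
  have hCσ_top : Cσ = ⊤ := (hirr.eq_bot_or_eq_top Cσ).resolve_left hCσ_ne
  rw [eq_top_iff]
  intro m _
  have hm : (m : W) ∈ (⊤ : Subrepresentation σ) := trivial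
  rw [← hCσ_top] at hm
  exact hm

/-- **STUB CL OF THE (C) DESK — local types exist** (the registered body of `StubCLLocalTypeExists` with the Lines-local `IsLocalTypeAt`
unfolded): an irreducible admissible representation `σ` of `U(J)(𝔸_{F,f})` has, at every finite place `v`, an IRREDUCIBLE representation `τ`
of `U(J)(F_v)` whose isotypic component in `σ|_{U(J)(F_v)}` is everything.  Proof: Flath's purification (★ `exists_purified_at`) inside the
transport of `σ` to the restricted product (★ `finAdelicEquiv`), then brick (iv). [cite: FlathCorvallis1979, Thm. 2 and §2 Example 2]
[cite: Bump1997, §3.4 Prop. 3.4.1 and Thm. 3.4.4] [cite: BorelJacquet1979, §4.3] -/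
theorem stubCL_holds :
    ∀ (F E : Type) [Field F] [NumberField F] [Field E] [NumberField E] [Algebra F E] (c : E ≃ₐ[F] E) (N : ℕ)
      (J : Matrix (Fin N) (Fin N) E) (W : Type) [AddCommGroup W] [Module ℂ W] (σ : Representation ℂ (finAdelic F E c N J) W),
      σ.IsIrreducible → σ.IsAdmissible → ∀ v : HeightOneSpectrum (𝓞 F),
        ∃ (T : Type) (_ : AddCommGroup T) (_ : Module ℂ T) (τ : Representation ℂ (localPi E c N J v) T),
          τ.IsIrreducible ∧
            isotypicComponent (MonoidAlgebra ℂ (localPi E c N J v)) (Representation.asModule (σ.comp (inclPlace F E c N J v)))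
              (Representation.asModule τ) = ⊤ := by
  intro F E _ _ _ _ _ c N J W _ _ σ hirr hadm v
  classical
  -- (0) transport to the restricted product
  let e := finAdelicEquiv F E c N J
  let π : Representation ℂ (Πʳ w : HeightOneSpectrum (𝓞 F), [localPi E c N J w, localInt E c N J w]) W :=
    σ.comp e.symm.toMulEquiv.toMonoidHom
  have hπι : ∀ g : localPi E c N J v,
      π (mulSingleHom (fun w => localInt E c N J w) v g) = σ (inclPlace F E c N J v g) := fun g => rfl
  haveI hπirr : π.IsIrreducible := isIrreducible_comp_mulEquiv σ e.symm.toMulEquiv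
  have hπadm : π.IsAdmissible :=
    hadm.comp_mulEquiv e.symm.toMulEquiv e.symm.continuous e.symm.isOpenMap
  -- (1) a box with non-zero fixed vectors, and purification at `v`
  obtain ⟨L, hLo, hLc, hLK, hLK', hU⟩ := exists_boxSubgroup_fixedPoints_ne_bot π
    (fun w => isOpen_localInt E c N J w) (fun w => isCompact_localInt E c N J w) hπadm.1
  obtain ⟨w₀, hw₀U, hw₀0⟩ := Submodule.exists_mem_ne_zero_of_ne_bot hU
  obtain ⟨w', -, hw'0, hirrU, -⟩ := exists_purified_at π hπadm hLo hLc hLK hLK' hw₀U hw₀0 v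
  -- the cyclic module `C_v(w′)` as a subrepresentation of `σ|_{U(J)(F_v)}`
  let Usp : Submodule ℂ W :=
    Submodule.span ℂ (Set.range fun g : localPi E c N J v =>
      π (mulSingleHom (fun w => localInt E c N J w) v g) w')
  let Uσ : Subrepresentation (σ.comp (inclPlace F E c N J v)) :=
    { toSubmodule := Usp
      apply_mem_toSubmodule := fun g x hx => by
        have h := apply_mem_span_range_mulSingleHom π v w' g hx
        rwa [hπι] at h }
  have hUne : Usp ≠ ⊥ := span_range_mulSingleHom_ne_bot π v hw'0
  let τ : Representation ℂ (localPi E c N J v) Usp := Uσ.toRepresentation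
  have hτ_apply : ∀ (g : localPi E c N J v) (u : Usp), ((τ g u : Usp) : W) = σ (inclPlace F E c N J v g) u := fun g u => rfl
  -- (2) `τ` is irreducible: its subrepresentations are `U(J)(F_v)`-stable subspaces of `C_v(w′)`
  have hτirr : τ.IsIrreducible := by
    haveI : Nontrivial (Subrepresentation τ) := by
      obtain ⟨u, huU, hu0⟩ := Submodule.exists_mem_ne_zero_of_ne_bot hUne
      refine ⟨⟨⊥, ⊤, fun h => hu0 ?_⟩⟩
      have hmem : (⟨u, huU⟩ : Usp) ∈ (⊤ : Subrepresentation τ) := trivial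
      rw [← h] at hmem
      have h0 : (⟨u, huU⟩ : Usp) = 0 := hmem
      exact congrArg Subtype.val h0
    refine ⟨fun Nr => ?_⟩
    set X : Submodule ℂ W := Nr.toSubmodule.map Usp.subtype with hX
    have hXle : X ≤ Usp := Submodule.map_subtype_le _ _
    have hXst : ∀ g : localPi E c N J v, ∀ x ∈ X,
        π (mulSingleHom (fun w => localInt E c N J w) v g) x ∈ X := by
      rintro g _ ⟨n, hn, rfl⟩
      refine ⟨τ g n, Nr.apply_mem_toSubmodule g hn, ?_⟩
      rw [hπι]
      rfl
    rcases hirrU X hXle hXst with h0 | h1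
    · left
      apply Subrepresentation.toSubmodule_injective
      have : Nr.toSubmodule = ⊥ := by
        have hinj := Submodule.map_injective_of_injective (f := Usp.subtype) Subtype.val_injective
        apply hinj
        rw [Submodule.map_bot]
        exact h0
      exact this
    · right
      apply Subrepresentation.toSubmodule_injective
      have hinj := Submodule.map_injective_of_injective (f := Usp.subtype) Subtype.val_injective
      apply hinj
      rw [← hX, h1]
      change Usp = Submodule.map Usp.subtype ⊤
      rw [Submodule.map_top, Submodule.range_subtype]
  refine ⟨Usp, inferInstance, inferInstance, τ, hτirr, ?_⟩
  -- (3) the isotypic component is everything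
  haveI := hτirr
  -- the inclusion `C_v(w′) ↪ W` as a `ℂ[U(J)(F_v)]`-linear map `τ.asModule → (σ ∘ ι_v).asModule`, and its range `Um`
  let fsub : τ.IntertwiningMap (σ.comp (inclPlace F E c N J v)) :=
    LinearMap.intertwiningMap_of_isIntertwiningMap _ _ Usp.subtype fun g u => rfl
  let Fm := Representation.IntertwiningMap.equivLinearMapAsModule τ (σ.comp (inclPlace F E c N J v)) fsub
  have hFm_apply : ∀ t : Representation.asModule τ, Fm t = Usp.subtype t := fun t => rfl
  have hFinj : Function.Injective Fm := fun a b h =>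
    Submodule.injective_subtype Usp (by rwa [hFm_apply, hFm_apply] at h)
  let Um : Submodule (MonoidAlgebra ℂ (localPi E c N J v)) (Representation.asModule (σ.comp (inclPlace F E c N J v))) :=
    Uσ.asSubmodule
  have hFrange : LinearMap.range Fm = Um := by
    ext m
    constructor
    · rintro ⟨t, rfl⟩
      rw [hFm_apply]
      exact t.2
    · intro hm
      exact ⟨⟨m, hm⟩, rfl⟩
  let eU : Representation.asModule τ ≃ₗ[MonoidAlgebra ℂ (localPi E c N J v)] Um :=
    (LinearEquiv.ofInjective Fm hFinj).trans (LinearEquiv.ofEq _ _ hFrange)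
  rw [eU.isotypicComponent_eq]
  haveI : IsSimpleModule (MonoidAlgebra ℂ (localPi E c N J v)) Um := IsSimpleModule.congr eU.symm
  refine isotypicComponent_place_eq_top_of_ne_bot F E c N J hirr v Um ?_
  intro h0
  apply hw'0
  have hwC : w' ∈ isotypicComponent (MonoidAlgebra ℂ (localPi E c N J v))
      (Representation.asModule (σ.comp (inclPlace F E c N J v))) Um :=
    Submodule.le_isotypicComponent Um (self_mem_span_range_mulSingleHom π v w')
  rw [h0] at hwC
  exact hwC

end Summit.HodgeConjecture.HodgeConjecture.Cruxes.H413.F0P2cStubCLLocalTypeExists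

end
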